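/-
Copyright (c) 2026 the pub-hodgecm-mathlib formalisation cell (harness21).  Prover seat hodgecm-mathlib-LH7-p01 (g3): line LH7 (closer row `stub_PKtupleK2`, #181 III-127;
h413 = stmt-HodgeConjecture-24833), leaf ED. 3 print organ O8b `PKmultOneU2Shape` — PAID IN-HOUSE; 2026-09-02.
-/
import Summits.HodgeConjecture.HodgeConjecture.Theorems.F0P3cPKtupleU2FinAdelicIsotypy      -- ★ p850482 (this seat): places → `U(Φ₂)(𝔸_f)` at `(η ψ) ∘ det` (+ ★ p850173 `Realises₂` ⟺ line, ★ (β) `PKmultOneU2Shape`)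
import Summits.HodgeConjecture.HodgeConjecture.Theorems.F0P3cPKtupleU2LocalIsotypyFull      -- ★ p850519 (F0P3a-p03 (g21)): `forall_toContRep_inclPlaceAdelic_apply_eq_smul_of_realises₂` (the local head, binder-free)
import Literature.NumberTheory.Automorphic.UnitaryGroupFiniteAdelicDenseOrbit               -- ★ p850540 (LH7-p04 (g3)): `eq_ofChar_of_forall_finAdelicToAdelic_apply_eq_smul` (Moore ergodicity ★ p850510 + twist ★ p850522)
import Literature.NumberTheory.Automorphic.UnitaryGroupRealApproximation                    -- ★ `denseRange_rationalToArch_cm` (real approximation for `U(H)` over a CM field, Cayley)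
import HarnessLib

/-!
# LH7 leaf ED. 3 — the print organ O8b `PKmultOneU2Shape L` («multiplicity one for one-dimensional automorphic representations of `U(Φ₂)`») is PROVED
# ([Rogawski1990] §13.3 p. 203 «`m(ξ) = 1`»)

Cell `pub/hodgecm-mathlib` (D-0151), crux H413 = `stmt-HodgeConjecture-24833`, half A line LH7 (closer row `stub_PKtupleK2 : PKtupleLetterK2`, books #181 III-127), banked leaf
ED. 3 «H-SIDE ROWS DERIVED» (sorries {O1″, O2, O8a `stub_PKsaU2`, O8b `stub_PKmultOneU2`}).  THEOREMS ONLY (kernel lane; no `def`, no instance, no notation, no named fact, no `sorry`).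
THIS FILE discharges the organ O8b: **`pkMultOneU2Shape_holds (L) : PKmultOneU2Shape L`** — the letter ★ (β) p849785 `Theorems/F0P3cPKtupleHSideLetters` :145, token for token,
so the leaf's `stub_PKmultOneU2 : ∀ L …, PKmultOneU2Shape L` is `fun L _ _ _ => pkMultOneU2Shape_holds L`.  The proof is the assembly of the cell's O8b chain (2026-09-02):
* (i) LOCAL (F0P3a-p03 (g20∕g21)): `Realises₂ P₂ ξ` ⇒ every `u ∈ U(Φ₂)(L⁺_v)` acts on the `U(Φ₂)(𝔸_f)`-smooth vectors of `P₂` by `(η ψ)(det (ι_v u))` — ★ p850240 (compact subgroups) →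
  ★ p850416∕p850430∕p850491 (DET-SCALAR road: Schur for the central `ι_v(det g · 1)`) → ★ p850490∕p850502∕p850516 ((SU-GEN)_v at split and non-split `v`) → ★ p850519
  `forall_toContRep_inclPlaceAdelic_apply_eq_smul_of_realises₂`;
* (ii) PLACES → `U(Φ₂)(𝔸_{L⁺,f})` ON ALL OF `P₂` (this seat): ★ p850461 `DiscreteAutomorphicRepFinAdelicScalar` (cofinite-box factorisation, density of smooth vectors from irreducibility)
  → ★ p850482 `toContRep_finAdelicToAdelic_apply_eq_smul_of_forall_inclPlaceAdelic₂`;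
* (iii) ARCHIMEDEAN: Moore ergodicity of the closed normal `U(Φ₂)(𝔸_{L⁺,f}) ⊴ U(Φ₂)(𝔸_{L⁺})` (LH7-p04 (g3) ★ p850510, twist ★ p850522, sockets ★ p850540) under the density of
  `U(Φ₂)(𝔸_{L⁺,f}) · U(Φ₂)(L⁺)`, which is REAL APPROXIMATION «`U(Φ₂)(L⁺)` dense in `U(Φ₂)(L⁺ ⊗ ℝ)`» — a theorem of the tree, ★ `denseRange_rationalToArch_cm` (Cayley's method, ★
  `GroupTheory/ArithmeticGroups/UnitaryRealApproximationCM`), here at `H = Φ₂` (§1);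
* (iv) the LINE: a discrete automorphic `P₂` on which `U(Φ₂)(𝔸_{L⁺,f})` acts by `Θ = (η ψ) ∘ det` is `ofChar Θ⁻¹ μ₂` (★ p850540 ∘ (iii)); two realising `P₂, P₂′` are both that line (§2–§3).
CONTENTS (namespace `…Cruxes.H413.F0P3cPKtupleMultOneU2`):
* §1 `denseRange_archPart_toAdelic_cm` — real approximation in ★ p850540's spelling `DenseRange fun γ => archPart … (toAdelic γ)`, for any non-degenerate hermitian `H` over a CM field
  (★ `denseRange_rationalToArch_cm` + the entrywise identity `(γ)_∞ = γ ⊗ 1`); `denseRange_archPart_toAdelic₂` — the case `H = Φ₂`.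
* §2 `toContRep_finAdelicToAdelic_apply_eq_smul_of_realises₂` — `Realises₂ P₂ ξ` ⇒ `R(1, b) f = (η ψ)(det b) • f` for every `b ∈ U(Φ₂)(𝔸_{L⁺,f})`, `f ∈ P₂` ((i) + (ii));
  **`eq_ofChar_of_realises₂`** — `Realises₂ P₂ ξ ⇒ P₂ = ofChar ((η ψ) ∘ det)⁻¹ μ₂`; `realises₂_iff_eq_ofChar` (the `U(Φ₂)` twin of ★ `realises₁_iff_eq_ofChar`, now letter-free).
* §3 **`pkMultOneU2Shape_holds : PKmultOneU2Shape L`** — O8b; `isotypy_of_realises₂` — the ISOTYPY text (O8b♭) `R(g) f = (η ψ)(det g) • f` for ALL `g ∈ U(Φ₂)(𝔸_{L⁺})`;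
  `realises₂_unique` — the premise `hm1` of ★ O7 `F0P3cPKtupleNHOneOfKD5H.nH_eq_one_of_kd5Hflat`, letter-free.
HONEST LABEL: O8b is no longer a print input of the LH7 leaf (count moves only when the registrar re-ties ED. 3 on the director's ORDER); the leaf's remaining print organs are O1″, O2, O8a.
HC_CM is proved only modulo the 7 printed citations (2 remaining: hLiu418 = stmt-HodgeConjecture-24832, h413 = stmt-HodgeConjecture-24833) until rung 0 closes.

## References
* [Rogawski1990] J. D. Rogawski, *Automorphic Representations of Unitary Groups in Three Variables* (1990), §13.3 pp. 202–203 (`m(ξ) = 1`).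
* [PlatonovRapinchuk1994] V. Platonov, A. Rapinchuk, *Algebraic Groups and Number Theory* (1994), §7.1 Thm. 7.7 p. 415 (real approximation), §7.3 Prop. 7.8.
* [Zimmer1984] R. J. Zimmer, *Ergodic theory and semisimple groups* (1984), §2.2 Cor. 2.2.3 (Moore's ergodicity duality).
* [Gelbart1975] S. Gelbart, *Automorphic forms on adele groups* (1975), Thm. 10.10 (proof, p. 158).
-/

set_option autoImplicit false
-- the mandated namespace repeats the single-problem summit's segment (`HodgeConjecture.HodgeConjecture`)
set_option linter.dupNamespace false

noncomputable section

namespace Summit.HodgeConjecture.HodgeConjecture.Cruxes.H413.F0P3cPKtupleMultOneU2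

open MeasureTheory NumberField IsDedekindDomain
open scoped Matrix
open Literature.NumberTheory Literature.NumberTheory.Automorphic Literature.NumberTheory.Automorphic.UnitaryGroup
open Literature.NumberTheory.Rogawski1990 Literature.NumberTheory.GaloisRepresentations
open Literature.NumberTheory.Automorphic.Arthur2013.Leaves.TECR
open Summit.HodgeConjecture.HodgeConjecture.Cruxes.H413.F0P3GlobalPacketDiscrete
open Summit.HodgeConjecture.HodgeConjecture.Cruxes.H413.F0P3cPKtupleHSideLetters
open Summit.HodgeConjecture.HodgeConjecture.Cruxes.H413.F0P3cPKtupleU1Line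
open Summit.HodgeConjecture.HodgeConjecture.Cruxes.H413.F0P3cPKtupleU2LineUnique
open Summit.HodgeConjecture.HodgeConjecture.Cruxes.H413.F0P3cPKtupleU2FinAdelicIsotypy
open Summit.HodgeConjecture.HodgeConjecture.Cruxes.H413.F0P3cPKtupleU2LocalIsotypyFull

variable (L : Type) [Field L] [NumberField L] [IsCMField L]

/-! ## §1 Real approximation for `U(H)` over a CM field, in the spelling `DenseRange fun γ => archPart (toAdelic γ)` -/

/-- `(γ)_∞ = γ ⊗ 1` entrywise: the archimedean component (★ `archPart`) of the diagonal image (★ `toAdelic`) of a rational point is ★ `rationalToArch γ` (Mathlib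
`InfiniteAdeleRing.mixedEmbedding_eq_algebraMap_comp`; the tree's `archPart_toAdelic`, re-proved privately to keep the import light). [cite: PlatonovRapinchuk1994, §7.1 Thm 7.7] -/
private theorem archPart_toAdelic_aux {F E : Type} [Field F] [NumberField F] [Field E] [NumberField E] [Algebra F E] (c : E ≃ₐ[F] E) (N : ℕ)
    (J : Matrix (Fin N) (Fin N) E) (γ : rational F E c N J) :
    archPart F E c N J ((adelicGroupData F E c N J).toAdelic γ) = rationalToArch F E c N J γ := by
  refine Subtype.ext (Matrix.GeneralLinearGroup.ext fun i j => ?_)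
  show InfiniteAdeleRing.ringEquiv_mixedSpace E
      ((algebraMap E (AdeleRing (𝓞 E) E) (((γ : rational F E c N J) : GL (Fin N) E) i j)).1) =
    NumberField.mixedEmbedding E (((γ : rational F E c N J) : GL (Fin N) E) i j)
  rw [InfiniteAdeleRing.mixedEmbedding_eq_algebraMap_comp]
  rfl

/-- **REAL APPROXIMATION for `U(H)` over a CM field, in ★ p850540's spelling**: for a non-degenerate hermitian `H ∈ M_N(L)` (`ᵗ(c̄ H) = H`, `det H` a unit) the archimedean
components of the rational points `U(H)(L⁺)` are DENSE in `U(H)(L ⊗ ℝ)` — the tree's theorem ★ `denseRange_rationalToArch_cm` ([PlatonovRapinchuk1994] Thm. 7.7 for the connected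
`L⁺`-group `U(H)`, proved in ★ `UnitaryRealApproximationCM` by Cayley's method). [cite: PlatonovRapinchuk1994, §7.1 Thm 7.7] -/
theorem denseRange_archPart_toAdelic_cm (N : ℕ) (H : Matrix (Fin N) (Fin N) L) (hH : (H.map (IsCMField.complexConj L))ᵀ = H) (hdet : IsUnit H.det) :
    DenseRange fun γ : (adelicGroupData ↥(maximalRealSubfield L) L (IsCMField.complexConj L) N H).Rational =>
      archPart ↥(maximalRealSubfield L) L (IsCMField.complexConj L) N H
        ((adelicGroupData ↥(maximalRealSubfield L) L (IsCMField.complexConj L) N H).toAdelic γ) := by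
  have h : (fun γ : (adelicGroupData ↥(maximalRealSubfield L) L (IsCMField.complexConj L) N H).Rational =>
      archPart ↥(maximalRealSubfield L) L (IsCMField.complexConj L) N H
        ((adelicGroupData ↥(maximalRealSubfield L) L (IsCMField.complexConj L) N H).toAdelic γ)) =
      (rationalToArch ↥(maximalRealSubfield L) L (IsCMField.complexConj L) N H : _ → _) := by
    funext γ
    exact archPart_toAdelic_aux (IsCMField.complexConj L) N H γ
  rw [h]
  exact denseRange_rationalToArch_cm N L H hH hdet

/-- **Real approximation for the quasi-split `U(Φ₂)`** (`Φ₂ = antidiag(1,1)`: hermitian by ★ `antidiagOne_map_transpose`, unit determinant by ★ `isUnit_antidiagOne_det`).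
[cite: PlatonovRapinchuk1994, §7.1 Thm 7.7] -/
theorem denseRange_archPart_toAdelic₂ :
    DenseRange fun γ : (adelicGroupData ↥(maximalRealSubfield L) L (IsCMField.complexConj L) 2 (Matrix.of fun i j : Fin 2 => if i.val + j.val + 1 = 2 then (1 : L) else 0)).Rational =>
      archPart ↥(maximalRealSubfield L) L (IsCMField.complexConj L) 2 (Matrix.of fun i j : Fin 2 => if i.val + j.val + 1 = 2 then (1 : L) else 0)
        ((adelicGroupData ↥(maximalRealSubfield L) L (IsCMField.complexConj L) 2 (Matrix.of fun i j : Fin 2 => if i.val + j.val + 1 = 2 then (1 : L) else 0)).toAdelic γ) :=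
  denseRange_archPart_toAdelic_cm L 2 _ (antidiagOne_map_transpose (IsCMField.complexConj L) 2) (isUnit_antidiagOne_det L 2)

variable {L}

/-! ## §2 `Realises₂ P₂ ξ` ⇒ `P₂` is the line of `((η ψ) ∘ det)⁻¹` -/

/-- **`Realises₂ P₂ ξ` ⇒ `U(Φ₂)(𝔸_{L⁺,f})` acts on ALL of `P₂` by `(η ψ)(det b)`**: the local head ★ p850519 `forall_toContRep_inclPlaceAdelic_apply_eq_smul_of_realises₂` fed into ★ p850482
`toContRep_finAdelicToAdelic_apply_eq_smul_of_forall_inclPlaceAdelic₂`. [cite: Rogawski1990, §13.3 p. 203] -/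
theorem toContRep_finAdelicToAdelic_apply_eq_smul_of_realises₂
    {μ₂ : Measure (adelicGroupData ↥(maximalRealSubfield L) L (IsCMField.complexConj L) 2 (Matrix.of fun i j : Fin 2 => if i.val + j.val + 1 = 2 then (1 : L) else 0)).automorphicQuotient}
    [(adelicGroupData ↥(maximalRealSubfield L) L (IsCMField.complexConj L) 2 (Matrix.of fun i j : Fin 2 => if i.val + j.val + 1 = 2 then (1 : L) else 0)).IsAutomorphicMeasure μ₂]
    (P₂ : DiscreteAutomorphicRep (adelicGroupData ↥(maximalRealSubfield L) L (IsCMField.complexConj L) 2 (Matrix.of fun i j : Fin 2 => if i.val + j.val + 1 = 2 then (1 : L) else 0)) μ₂) (ξ : OneDimAutRepH L)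
    (h : Realises₂ P₂ ξ)
    (b : ↥(finAdelic ↥(maximalRealSubfield L) L (IsCMField.complexConj L) 2 (Matrix.of fun i j : Fin 2 => if i.val + j.val + 1 = 2 then (1 : L) else 0)))
    (f : ↥P₂.space.toSubmodule) :
    P₂.space.toContRep (finAdelicToAdelic ↥(maximalRealSubfield L) L (IsCMField.complexConj L) 2 (Matrix.of fun i j : Fin 2 => if i.val + j.val + 1 = 2 then (1 : L) else 0) b) f =
      (((cmDetChar L 2 (Matrix.of fun i j : Fin 2 => if i.val + j.val + 1 = 2 then (1 : L) else 0) (ξ.η * ξ.ψ) (isAutomorphic_eta_mul_psi ξ) (isUnit_antidiagOne_det L 2).ne_zero)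
        (finAdelicToAdelic ↥(maximalRealSubfield L) L (IsCMField.complexConj L) 2 (Matrix.of fun i j : Fin 2 => if i.val + j.val + 1 = 2 then (1 : L) else 0) b) : ℂˣ) : ℂ) • f :=
  toContRep_finAdelicToAdelic_apply_eq_smul_of_forall_inclPlaceAdelic₂ P₂ ξ
    (fun v u f hf => forall_toContRep_inclPlaceAdelic_apply_eq_smul_of_realises₂ P₂ ξ h v u f hf) b f

/-- **`Realises₂ P₂ ξ` ⇒ `P₂` IS THE LINE `ofChar ((η ψ) ∘ det)⁻¹ μ₂`** — (ii) `U(Φ₂)(𝔸_{L⁺,f})` acts on `P₂` by `Θ = (η ψ) ∘ det` (§2), (iii)+(iv) ★ p850540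
`eq_ofChar_of_forall_finAdelicToAdelic_apply_eq_smul` (Moore ergodicity + twist) at the automorphic character `Θ⁻¹`, with its weak-approximation hypothesis `hWA` supplied by
`denseRange_archPart_toAdelic₂` (real approximation, ★), at the locally compact second countable `U(Φ₂)(𝔸_{L⁺})` (★ `locallyCompactSpace_cmDatum_Adelic`, ★ `secondCountableTopology_cmDatum_Adelic`).
[cite: Rogawski1990, §13.3 p. 203] [cite: Zimmer1984, §2.2 Cor. 2.2.3] [cite: PlatonovRapinchuk1994, §7.1 Thm 7.7] -/
theorem eq_ofChar_of_realises₂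
    {μ₂ : Measure (adelicGroupData ↥(maximalRealSubfield L) L (IsCMField.complexConj L) 2 (Matrix.of fun i j : Fin 2 => if i.val + j.val + 1 = 2 then (1 : L) else 0)).automorphicQuotient}
    [(adelicGroupData ↥(maximalRealSubfield L) L (IsCMField.complexConj L) 2 (Matrix.of fun i j : Fin 2 => if i.val + j.val + 1 = 2 then (1 : L) else 0)).IsAutomorphicMeasure μ₂]
    (P₂ : DiscreteAutomorphicRep (adelicGroupData ↥(maximalRealSubfield L) L (IsCMField.complexConj L) 2 (Matrix.of fun i j : Fin 2 => if i.val + j.val + 1 = 2 then (1 : L) else 0)) μ₂) (ξ : OneDimAutRepH L)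
    (h : Realises₂ P₂ ξ) :
    P₂ = DiscreteAutomorphicRep.ofChar (cmDetChar L 2 (Matrix.of fun i j : Fin 2 => if i.val + j.val + 1 = 2 then (1 : L) else 0) (ξ.η * ξ.ψ) (isAutomorphic_eta_mul_psi ξ) (isUnit_antidiagOne_det L 2).ne_zero)⁻¹ μ₂ := by
  haveI : LocallyCompactSpace (adelicGroupData ↥(maximalRealSubfield L) L (IsCMField.complexConj L) 2 (Matrix.of fun i j : Fin 2 => if i.val + j.val + 1 = 2 then (1 : L) else 0)).Adelic :=
    locallyCompactSpace_cmDatum_Adelic L 2 _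
  haveI : SecondCountableTopology (adelicGroupData ↥(maximalRealSubfield L) L (IsCMField.complexConj L) 2 (Matrix.of fun i j : Fin 2 => if i.val + j.val + 1 = 2 then (1 : L) else 0)).Adelic :=
    secondCountableTopology_cmDatum_Adelic L 2 _
  refine eq_ofChar_of_forall_finAdelicToAdelic_apply_eq_smul ↥(maximalRealSubfield L) L (IsCMField.complexConj L) 2 _ μ₂ (denseRange_archPart_toAdelic₂ L) P₂ _ fun b v => ?_
  rw [toContRep_finAdelicToAdelic_apply_eq_smul_of_realises₂ P₂ ξ h b v, AdelicGroupData.AutomorphicCharacter.coe_inv_apply, inv_inv]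

/-- **`Realises₂ P₂ ξ ↔ P₂ = ofChar ((η ψ) ∘ det)⁻¹ μ₂`** — the `U(Φ₂)` twin of ★ `realises₁_iff_eq_ofChar`, now WITHOUT the letter O8b (★ p850173 `realises₂_iff_eq_ofChar_of_pkMultOneU2Shape`
took it as a hypothesis); `←` is ★ `realises₂_ofChar`. [cite: Rogawski1990, §13.3 pp. 202–203] -/
theorem realises₂_iff_eq_ofChar
    {μ₂ : Measure (adelicGroupData ↥(maximalRealSubfield L) L (IsCMField.complexConj L) 2 (Matrix.of fun i j : Fin 2 => if i.val + j.val + 1 = 2 then (1 : L) else 0)).automorphicQuotient}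
    [(adelicGroupData ↥(maximalRealSubfield L) L (IsCMField.complexConj L) 2 (Matrix.of fun i j : Fin 2 => if i.val + j.val + 1 = 2 then (1 : L) else 0)).IsAutomorphicMeasure μ₂]
    (P₂ : DiscreteAutomorphicRep (adelicGroupData ↥(maximalRealSubfield L) L (IsCMField.complexConj L) 2 (Matrix.of fun i j : Fin 2 => if i.val + j.val + 1 = 2 then (1 : L) else 0)) μ₂) (ξ : OneDimAutRepH L) :
    Realises₂ P₂ ξ ↔
      P₂ = DiscreteAutomorphicRep.ofChar (cmDetChar L 2 (Matrix.of fun i j : Fin 2 => if i.val + j.val + 1 = 2 then (1 : L) else 0) (ξ.η * ξ.ψ) (isAutomorphic_eta_mul_psi ξ) (isUnit_antidiagOne_det L 2).ne_zero)⁻¹ μ₂ :=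
  ⟨eq_ofChar_of_realises₂ P₂ ξ, fun hP => hP ▸ realises₂_ofChar ξ⟩

/-! ## §3 O8b `PKmultOneU2Shape L` — PROVED -/

/-- **TWO REALISING `P₂, P₂′` COINCIDE** (both are the line `ofChar ((η ψ) ∘ det)⁻¹ μ₂`, §2) — the premise `hm1` of ★ O7 `F0P3cPKtupleNHOneOfKD5H.nH_eq_one_of_kd5Hflat`, letter-free.
[cite: Rogawski1990, §13.3 p. 203] -/
theorem realises₂_unique
    {μ₂ : Measure (adelicGroupData ↥(maximalRealSubfield L) L (IsCMField.complexConj L) 2 (Matrix.of fun i j : Fin 2 => if i.val + j.val + 1 = 2 then (1 : L) else 0)).automorphicQuotient}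
    [(adelicGroupData ↥(maximalRealSubfield L) L (IsCMField.complexConj L) 2 (Matrix.of fun i j : Fin 2 => if i.val + j.val + 1 = 2 then (1 : L) else 0)).IsAutomorphicMeasure μ₂] (ξ : OneDimAutRepH L)
    (P₂ P₂' : DiscreteAutomorphicRep (adelicGroupData ↥(maximalRealSubfield L) L (IsCMField.complexConj L) 2 (Matrix.of fun i j : Fin 2 => if i.val + j.val + 1 = 2 then (1 : L) else 0)) μ₂)
    (h : Realises₂ P₂ ξ) (h' : Realises₂ P₂' ξ) : P₂ = P₂' :=
  (eq_ofChar_of_realises₂ P₂ ξ h).trans (eq_ofChar_of_realises₂ P₂' ξ h').symm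

variable (L) in
/-- **O8b `PKmultOneU2Shape L` (PRINT S letter ★ (β) p849785 :145, [Rogawski1990] §13.3 p. 203 «`m(ξ) = 1`») — PROVED**: «two discrete automorphic representations `P₂, P₂′` of
`U(Φ₂)` in `L²(μ₂)` realising the same character family `ξ_v ∘ inl` at every finite place COINCIDE», for every automorphic `μ₂` and every one-dimensional automorphic `ξ` of `H`.
The leaf ED. 3 organ `stub_PKmultOneU2 : ∀ L …, PKmultOneU2Shape L` is `fun L _ _ _ => pkMultOneU2Shape_holds L`. [cite: Rogawski1990, §13.3 p. 203] [cite: PlatonovRapinchuk1994, §7.1 Thm 7.7]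
[cite: Zimmer1984, §2.2 Cor. 2.2.3] -/
theorem pkMultOneU2Shape_holds : PKmultOneU2Shape L :=
  fun _μ₂ _ ξ P₂ P₂' h h' => realises₂_unique ξ P₂ P₂' h h'

/-- **The ISOTYPY text (O8b♭) under `Realises₂`: ALL of `U(Φ₂)(𝔸_{L⁺})` acts on `P₂` by `(η ψ)(det g)`** (★ p850173 `forall_apply_eq_smul_of_pkMultOneU2Shape` with the letter now proved;
equivalently ★ `realises₂_and_forall_apply_eq_smul_iff_eq_ofChar` at the line of §2). [cite: Rogawski1990, §13.3 p. 203] -/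
theorem isotypy_of_realises₂
    {μ₂ : Measure (adelicGroupData ↥(maximalRealSubfield L) L (IsCMField.complexConj L) 2 (Matrix.of fun i j : Fin 2 => if i.val + j.val + 1 = 2 then (1 : L) else 0)).automorphicQuotient}
    [(adelicGroupData ↥(maximalRealSubfield L) L (IsCMField.complexConj L) 2 (Matrix.of fun i j : Fin 2 => if i.val + j.val + 1 = 2 then (1 : L) else 0)).IsAutomorphicMeasure μ₂]
    (P₂ : DiscreteAutomorphicRep (adelicGroupData ↥(maximalRealSubfield L) L (IsCMField.complexConj L) 2 (Matrix.of fun i j : Fin 2 => if i.val + j.val + 1 = 2 then (1 : L) else 0)) μ₂) (ξ : OneDimAutRepH L)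
    (h : Realises₂ P₂ ξ)
    (g : (adelicGroupData ↥(maximalRealSubfield L) L (IsCMField.complexConj L) 2 (Matrix.of fun i j : Fin 2 => if i.val + j.val + 1 = 2 then (1 : L) else 0)).Adelic)
    (f : ↥P₂.space.toSubmodule) :
    P₂.space.toContRep g f =
      (((cmDetChar L 2 (Matrix.of fun i j : Fin 2 => if i.val + j.val + 1 = 2 then (1 : L) else 0) (ξ.η * ξ.ψ) (isAutomorphic_eta_mul_psi ξ) (isUnit_antidiagOne_det L 2).ne_zero) g : ℂˣ) : ℂ) • f :=
  forall_apply_eq_smul_of_pkMultOneU2Shape (pkMultOneU2Shape_holds L) ξ P₂ h g f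

end Summit.HodgeConjecture.HodgeConjecture.Cruxes.H413.F0P3cPKtupleMultOneU2

end
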